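import Literature.MathematicalPhysics.StatisticalMechanics.ComplexSpinFluctuationBound
import HarnessLib

/-!
# Chiral long-range order from an infrared bound and a nearest-neighbour lower bound, for a general
# chirally graded two-point kernel on the even torus (Salmhofer–Seiler, CMP 139 (1991), (4.12)–(4.14),
# Thm. 4.8 (4.40)–(4.42), with the infrared bound and the Schwinger–Dyson bound as HYPOTHESES)

[abstract] The printed proof of chiral long-range order (Thm. 4.8 ⇒ Cor. 4.9) combines three inputs on
the two-point function `T(x) = ⟨σ_0σ_x⟩_Λ` of the order field on `Λ = (ℤ/Lℤ)^ν` (`L` even):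
(IR) the infrared bound (3.112)–(3.113) MODE BY MODE on the dual torus, `2D(k) T̂(k) ≤ A` and
`-2D(k+π̂) T̂(k) ≤ A` for `k ∉ {0, π̂}` (at `β = 0`: `A = N⁻¹`, Thm. 3.21); (χ) chiral symmetry at `m = 0`,
`T(x) = 0` for `ε(x) = 1` ((3.101), hence `T̂(k+π̂) = -T̂(k)`, (3.106)); (SD) the Schwinger–Dyson
lower bound `∑_{|y|=1} T(y) ≥ b` ((4.38): `b = 1/K(N)`).  The step from these to
`|Λ|⁻¹∑_x T(x) ≥ (1/4ν)(b - 2A·S_Λ(ν))` ((4.12)–(4.14), (4.40)–(4.42); `S_Λ(ν)` the lattice sum (4.3) of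
the tree's `latticeS`) is linear algebra on the characters of the torus and uses NOTHING ELSE about the
model.  This file proves that step for an ARBITRARY translation-invariant symmetric real kernel
`G(x,y)` with (IR), (χ), (SD) as explicit hypotheses (`kernel_chiralLRO_of_bounds`) — the tree's
`ComplexSpinChiralLRO` is the instance `G = [σ_xσ_y]_Λ` at `β = 0`, where (IR) and (SD) are theorems.
Purpose: it is the model-independent half of the question "what does an extension of Salmhofer–Seiler
to small `β > 0` need" (cell pub-ymgap, rung Q1): at `β > 0` exactly (IR) and (SD), uniformly in the
volume, are the inputs not in print, and this lemma turns them into long-range order verbatim.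
The last section isolates the WEAKEST form in which (IR) is consumed: (4.12)–(4.13) split the
nearest-neighbour sum into the two atoms `k = 0, π̂` (`= 4ν ×` the order parameter, by the grading) plus
the regular part `|Λ|⁻¹∑_{k ∉ {0,π̂}} 2C(k)Ĝ(k)` (`sum_kernel_nbr_eq_order_add_regular`); ANY bound `r` on
the regular part gives order `≥ (1/4ν)(b - r)` (`kernel_chiralLRO_of_regularPart`), and a mode-wise bound
with slack `A + e(k)` gives `r = 2A·S_Λ(ν) + |Λ|⁻¹∑ e·(C/D folded)` (`regular_le_of_slack`,
`kernel_chiralLRO_of_slackBounds`).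

[scope] Finite even torus, exact inequalities; no thermodynamic limit here (`S_Λ(ν) → S(ν)` is the
tree's `latticeS_tendsto_fluctS`); nothing about `β > 0`, the continuum or the summit's `QCD` conjunct is
asserted.  Theorems only; no definitions, no facts, no `sorry`.

## References
* [SalmhoferSeiler1991] M. Salmhofer, E. Seiler, Commun. Math. Phys. 139 (1991) 395–432: (3.104)–(3.113)
  p. 415–416, Def. 4.1 (4.1)–(4.3) p. 417, (4.12)–(4.14) p. 419, Thm. 4.8 (4.38)–(4.42) pp. 422–423.
* [FrohlichSimonSpencer1976] J. Fröhlich, B. Simon, T. Spencer, Commun. Math. Phys. 50 (1976) 79–95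
  (the infrared-bound ⇒ long-range-order mechanism).
-/

noncomputable section

open Finset

namespace Literature.MathematicalPhysics.StatisticalMechanics

open Literature.Probability.LatticeModels (TorusSite)

namespace ComplexSpin

variable {ν L : ℕ} [NeZero L]

/-! ### Fourier analysis of a translation-invariant symmetric real kernel -/

/-- The symbol of a translation-invariant symmetric real kernel is real:
`∑_z G(0,z) χ(z) = Re ∑_z G(0,z) χ(z)`. [cite: SalmhoferSeiler1991, (3.105)] -/
theorem kernelSymbol_eq_ofReal_re {G : TorusSite ν L → TorusSite ν L → ℝ}
    (hT : ∀ x y a, G (x + a) (y + a) = G x y) (hS : ∀ x y, G x y = G y x)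
    (χ : AddChar (TorusSite ν L) ℂ) :
    kernelSymbol G χ = (((kernelSymbol G χ).re : ℝ) : ℂ) :=
  (Complex.conj_eq_iff_re.1 (conj_kernelSymbol hT hS χ)).symm

/-- The zero mode of the symbol is the volume sum: `Re ∑_z G(0,z) χ_0(z) = ∑_z G(0,z)`. [cite: SalmhoferSeiler1991, (3.108)] -/
theorem kernelSymbol_zero_re (G : TorusSite ν L → TorusSite ν L → ℝ) :
    (kernelSymbol G (0 : AddChar (TorusSite ν L) ℂ)).re = ∑ z : TorusSite ν L, G 0 z := by
  unfold kernelSymbol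
  rw [Complex.re_sum]
  exact Finset.sum_congr rfl fun z _ => by rw [AddChar.zero_apply, mul_one, Complex.ofReal_re]

/-- **Chiral grading (3.106)**: if `G(0,z) = 0` on even sites then `Ĝ(π̂) = -Ĝ(0)`. [cite: SalmhoferSeiler1991, (3.101) and (3.106)] -/
theorem kernelSymbol_stagChar_re_of_graded (hL : 2 ∣ L) {G : TorusSite ν L → TorusSite ν L → ℝ}
    (hχ : ∀ z, parity hL z = 0 → G 0 z = 0) :
    (kernelSymbol G (stagChar (ν := ν) (L := L) hL)).re =
      -(kernelSymbol G (0 : AddChar (TorusSite ν L) ℂ)).re := by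
  unfold kernelSymbol
  rw [← Complex.neg_re, ← Finset.sum_neg_distrib, Complex.re_sum, Complex.re_sum]
  refine Finset.sum_congr rfl fun z _ => ?_
  rw [AddChar.zero_apply, mul_one, stagChar_apply]
  by_cases hz : parity hL z = 0
  · rw [hχ z hz]; simp
  · rw [if_neg hz]; simp

/-- **Fourier inversion** for a translation-invariant symmetric real kernel:
`|Λ| G(0,ξ) = ∑_χ Ĝ(χ) conj χ(ξ)` (3.104). [cite: SalmhoferSeiler1991, (3.104)–(3.105)] -/
theorem card_mul_kernel_eq (G : TorusSite ν L → TorusSite ν L → ℝ) (ξ : TorusSite ν L) :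
    (Fintype.card (TorusSite ν L) : ℂ) * ((G 0 ξ : ℝ) : ℂ) =
      ∑ χ : AddChar (TorusSite ν L) ℂ, kernelSymbol G χ * starRingEnd ℂ (χ ξ) := by
  classical
  unfold kernelSymbol
  simp_rw [Finset.sum_mul]
  rw [Finset.sum_comm]
  have : ∀ z : TorusSite ν L, ∑ χ : AddChar (TorusSite ν L) ℂ,
      ((G 0 z : ℝ) : ℂ) * χ z * starRingEnd ℂ (χ ξ) =
      ((G 0 z : ℝ) : ℂ) * (if z = ξ then (Fintype.card (TorusSite ν L) : ℂ) else 0) := by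
    intro z
    rw [← sum_addChar_mul_conj z ξ, Finset.mul_sum]
    exact Finset.sum_congr rfl fun χ _ => by ring
  simp_rw [this, mul_ite, mul_zero]
  rw [Finset.sum_ite_eq' Finset.univ ξ, if_pos (Finset.mem_univ ξ), mul_comm]

/-- **The nearest-neighbour sum through the symbol** (4.12)–(4.13): for a translation-invariant
symmetric real kernel, `∑_μ (G(0,e_μ) + G(0,-e_μ)) = |Λ|⁻¹ ∑_χ Ĝ(χ) · 2C(χ)`. [cite: SalmhoferSeiler1991, (4.12)–(4.13) and (4.40)] -/
theorem sum_kernel_nbr_eq {G : TorusSite ν L → TorusSite ν L → ℝ}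
    (hT : ∀ x y a, G (x + a) (y + a) = G x y) (hS : ∀ x y, G x y = G y x) :
    ∑ μ : Fin ν, (G 0 (Pi.single μ 1) + G 0 (-Pi.single μ 1)) =
      (Fintype.card (TorusSite ν L) : ℝ)⁻¹ *
        ∑ χ : AddChar (TorusSite ν L) ℂ, (kernelSymbol G χ).re * (2 * cosSum χ) := by
  classical
  have hn : (Fintype.card (TorusSite ν L) : ℂ) ≠ 0 := Nat.cast_ne_zero.2 Fintype.card_ne_zero
  have key : (Fintype.card (TorusSite ν L) : ℂ) *
      ∑ μ : Fin ν, (((G 0 (Pi.single μ 1) : ℝ) : ℂ) + ((G 0 (-Pi.single μ 1) : ℝ) : ℂ)) =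
      ∑ χ : AddChar (TorusSite ν L) ℂ,
        (((kernelSymbol G χ).re : ℝ) : ℂ) * (2 * ((cosSum χ : ℝ) : ℂ)) := by
    rw [Finset.mul_sum]
    simp_rw [mul_add, card_mul_kernel_eq, ← Finset.sum_add_distrib]
    rw [Finset.sum_comm]
    refine Finset.sum_congr rfl fun χ _ => ?_
    simp_rw [← mul_add]
    rw [← Finset.mul_sum, kernelSymbol_eq_ofReal_re hT hS]
    congr 1
    rw [cosSum, Complex.ofReal_sum, Finset.mul_sum]
    refine Finset.sum_congr rfl fun μ _ => ?_
    rw [AddChar.map_neg_eq_conj, Complex.conj_conj, add_comm, Complex.add_conj]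
    push_cast
    ring
  apply Complex.ofReal_injective
  push_cast
  rw [← key, ← mul_assoc, inv_mul_cancel₀ hn, one_mul]

/-! ### The infrared bound mode by mode ⇒ the infrared form (4.40) of the nearest-neighbour sum -/

/-- **Per mode** (4.14): if `2(ν - C(χ)) Ĝ(χ) ≤ A` and `-2(ν + C(χ)) Ĝ(χ) ≤ A` at a mode
`χ ∉ {0, π̂}` (the two halves (3.112)–(3.113) of the infrared bound), then
`2 C(χ) Ĝ(χ) ≤ A · modeTerm(C(χ))`. [cite: SalmhoferSeiler1991, (4.14) with (3.112)–(3.113)] -/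
theorem two_cosSum_mul_kernelSymbol_re_le (hL : 2 ∣ L) {G : TorusSite ν L → TorusSite ν L → ℝ} {A : ℝ}
    {χ : AddChar (TorusSite ν L) ℂ} (h0 : χ ≠ 0) (hε : χ ≠ stagChar hL)
    (hIR₁ : 2 * ((ν : ℝ) - cosSum χ) * (kernelSymbol G χ).re ≤ A)
    (hIR₂ : 2 * ((ν : ℝ) + cosSum χ) * (-(kernelSymbol G χ).re) ≤ A) :
    2 * cosSum χ * (kernelSymbol G χ).re ≤ A * modeTerm ν (cosSum χ) := by
  set c := cosSum χ with hc
  set g := (kernelSymbol G χ).re with hg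
  unfold modeTerm
  rcases lt_trichotomy 0 c with hpos | hzero | hneg
  · rw [if_pos hpos]
    have hD : 0 < (ν : ℝ) - c := by have := cosSum_lt_of_ne_zero h0; rw [← hc] at this; linarith
    have hgle : g ≤ A / (2 * ((ν : ℝ) - c)) := by
      rw [le_div_iff₀ (by positivity)]; linarith
    calc 2 * c * g ≤ 2 * c * (A / (2 * ((ν : ℝ) - c))) := mul_le_mul_of_nonneg_left hgle (by positivity)
      _ = A * (c / (ν - c)) := by field_simp
  · rw [← hzero]; simp
  · rw [if_neg (not_lt.mpr hneg.le), if_pos hneg]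
    have hD : 0 < (ν : ℝ) + c := by
      have := neg_lt_cosSum_of_ne_stagChar hL hε; rw [← hc] at this; linarith
    have hgle : -g ≤ A / (2 * ((ν : ℝ) + c)) := by
      rw [le_div_iff₀ (by positivity)]; linarith
    calc 2 * c * g = 2 * (-c) * (-g) := by ring
      _ ≤ 2 * (-c) * (A / (2 * ((ν : ℝ) + c))) := mul_le_mul_of_nonneg_left hgle (by linarith)
      _ = A * (-c / (ν + c)) := by field_simp

/-- **(4.40) for a general kernel**: on the even torus `(ℤ/Lℤ)^ν` (`ν ≥ 1`), a translation-invariant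
symmetric real kernel obeying the mode-wise infrared bounds `2(ν - C(χ))Ĝ(χ) ≤ A`,
`-2(ν + C(χ))Ĝ(χ) ≤ A` for all `χ ∉ {0, π̂}` satisfies
`∑_μ (G(0,e_μ) + G(0,-e_μ)) ≤ (2ν/|Λ|)(Ĝ(0) - Ĝ(π̂)) + 2A·S_Λ(ν)`. [cite: SalmhoferSeiler1991, Thm. 4.8 (4.40) with (4.14)] -/
theorem sum_kernel_nbr_le (hν : 1 ≤ ν) (hL : Even L) {G : TorusSite ν L → TorusSite ν L → ℝ}
    (hT : ∀ x y a, G (x + a) (y + a) = G x y) (hS : ∀ x y, G x y = G y x) {A : ℝ}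
    (hIR : ∀ χ : AddChar (TorusSite ν L) ℂ, χ ≠ 0 → χ ≠ stagChar hL.two_dvd →
      2 * ((ν : ℝ) - cosSum χ) * (kernelSymbol G χ).re ≤ A ∧
        2 * ((ν : ℝ) + cosSum χ) * (-(kernelSymbol G χ).re) ≤ A) :
    ∑ μ : Fin ν, (G 0 (Pi.single μ 1) + G 0 (-Pi.single μ 1)) ≤
      2 * ν / (Fintype.card (TorusSite ν L) : ℝ) *
          ((kernelSymbol G (0 : AddChar (TorusSite ν L) ℂ)).re -
            (kernelSymbol G (stagChar (ν := ν) hL.two_dvd)).re) +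
        2 * A * latticeS ν L := by
  classical
  set ε := stagChar (ν := ν) (L := L) hL.two_dvd with hεdef
  set f : AddChar (TorusSite ν L) ℂ → ℝ := fun χ => (kernelSymbol G χ).re * (2 * cosSum χ) with hf
  set t : AddChar (TorusSite ν L) ℂ → ℝ := fun χ =>
    if χ = 0 ∨ χ = ε then 0 else modeTerm ν (cosSum χ) with ht
  have hε0 : ε ≠ 0 := stagChar_ne_zero hL.two_dvd hν
  have hn : (0 : ℝ) < Fintype.card (TorusSite ν L) := Nat.cast_pos.2 Fintype.card_pos
  -- pointwise: `f χ ≤ A t χ` off `{0, ε}`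
  have hpt : ∀ χ ∈ (Finset.univ.erase (0 : AddChar (TorusSite ν L) ℂ)).erase ε, f χ ≤ A * t χ := by
    intro χ hχ
    have hE : χ ≠ ε := Finset.ne_of_mem_erase hχ
    have h0 : χ ≠ 0 := Finset.ne_of_mem_erase (Finset.mem_of_mem_erase hχ)
    simp only [hf, ht, if_neg (not_or.mpr ⟨h0, hE⟩)]
    have := two_cosSum_mul_kernelSymbol_re_le hL.two_dvd h0 hE (hIR χ h0 hE).1 (hIR χ h0 hE).2
    linarith [this]
  -- split off the modes `0` and `ε`
  have hsumf : ∑ χ, f χ = f 0 + f ε + ∑ χ ∈ (Finset.univ.erase 0).erase ε, f χ := by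
    rw [← Finset.add_sum_erase _ _ (Finset.mem_univ (0 : AddChar (TorusSite ν L) ℂ)),
      ← Finset.add_sum_erase _ _ (Finset.mem_erase.mpr ⟨hε0, Finset.mem_univ ε⟩), add_assoc]
  have hsumt : ∑ χ, t χ = ∑ χ ∈ (Finset.univ.erase 0).erase ε, t χ := by
    rw [← Finset.add_sum_erase _ _ (Finset.mem_univ (0 : AddChar (TorusSite ν L) ℂ)),
      ← Finset.add_sum_erase _ _ (Finset.mem_erase.mpr ⟨hε0, Finset.mem_univ ε⟩)]
    simp [ht]
  have hrest : ∑ χ ∈ (Finset.univ.erase 0).erase ε, f χ ≤ A * ∑ χ ∈ (Finset.univ.erase 0).erase ε, t χ := by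
    rw [Finset.mul_sum]
    exact Finset.sum_le_sum hpt
  have ht_eq : ∑ χ, t χ = 2 * ((Fintype.card (TorusSite ν L) : ℝ) * latticeS ν L) :=
    sum_modeTerm_eq hL.two_dvd
  have hf0 : f 0 = (kernelSymbol G (0 : AddChar (TorusSite ν L) ℂ)).re * (2 * ν) := by
    simp only [hf, cosSum_zero]
  have hfε : f ε = (kernelSymbol G ε).re * (2 * (-(ν : ℝ))) := by
    simp only [hf, hεdef, cosSum_stagChar]
  rw [sum_kernel_nbr_eq hT hS, hsumf, hf0, hfε]
  rw [← hsumt, ht_eq] at hrest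
  rw [inv_mul_le_iff₀ hn]
  have hcalc : (Fintype.card (TorusSite ν L) : ℝ) *
      (2 * ν / (Fintype.card (TorusSite ν L) : ℝ) *
          ((kernelSymbol G (0 : AddChar (TorusSite ν L) ℂ)).re - (kernelSymbol G ε).re) +
        2 * A * latticeS ν L) =
      (kernelSymbol G (0 : AddChar (TorusSite ν L) ℂ)).re * (2 * ν) +
          (kernelSymbol G ε).re * (2 * -(ν : ℝ)) +
        A * (2 * ((Fintype.card (TorusSite ν L) : ℝ) * latticeS ν L)) := by
    field_simp
    ring
  rw [hcalc]
  linarith [hrest]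

/-! ### Long-range order from (IR) + (χ) + (SD) -/

/-- **Chiral long-range order from an infrared bound and a nearest-neighbour lower bound (Thm. 4.8,
(4.41)–(4.42), for a general graded kernel).**  Let `G` be a translation-invariant symmetric real
kernel on the even torus `(ℤ/Lℤ)^ν` (`ν ≥ 1`) with (χ) `G(0,z) = 0` on even sites `ε(z) = 1`, (IR)
`2(ν - C(χ))Ĝ(χ) ≤ A`, `-2(ν + C(χ))Ĝ(χ) ≤ A` for all characters `χ ∉ {0, π̂}`, and (SD)
`b ≤ ∑_μ (G(0,e_μ) + G(0,-e_μ))`.  Then `|Λ|⁻¹ ∑_x G(0,x) ≥ (1/4ν)(b - 2A·S_Λ(ν))` — the printed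
combination "`1 ≤ K(N)(4νc_0 + 2S(ν)/N)`, so `c_0 ≥ (1/4ν)(1/K(N) - 2S(ν)/N)`" with `b = 1/K(N)`,
`A = 1/N` as free constants and the lattice sum `S_Λ(ν)` in place of its limit `S(ν)`. [cite: SalmhoferSeiler1991, Thm. 4.8 ((4.40)–(4.42)) with (3.106)] -/
theorem kernel_chiralLRO_of_bounds (hν : 1 ≤ ν) (hL : Even L) {G : TorusSite ν L → TorusSite ν L → ℝ}
    (hT : ∀ x y a, G (x + a) (y + a) = G x y) (hS : ∀ x y, G x y = G y x)
    (hgrad : ∀ z, parity hL.two_dvd z = 0 → G 0 z = 0) {A b : ℝ}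
    (hIR : ∀ χ : AddChar (TorusSite ν L) ℂ, χ ≠ 0 → χ ≠ stagChar hL.two_dvd →
      2 * ((ν : ℝ) - cosSum χ) * (kernelSymbol G χ).re ≤ A ∧
        2 * ((ν : ℝ) + cosSum χ) * (-(kernelSymbol G χ).re) ≤ A)
    (hSD : b ≤ ∑ μ : Fin ν, (G 0 (Pi.single μ 1) + G 0 (-Pi.single μ 1))) :
    1 / (4 * ν) * (b - 2 * A * latticeS ν L) ≤
      (Fintype.card (TorusSite ν L) : ℝ)⁻¹ * ∑ x : TorusSite ν L, G 0 x := by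
  set n : ℝ := (Fintype.card (TorusSite ν L) : ℝ) with hn
  set g0 := ∑ x : TorusSite ν L, G 0 x with hg0
  have hνpos : (0 : ℝ) < ν := Nat.cast_pos.mpr hν
  have hnpos : 0 < n := Nat.cast_pos.2 Fintype.card_pos
  -- (4.40) with `Ĝ(π̂) = -Ĝ(0)` and `Ĝ(0) = ∑_x G(0,x)`
  have h40 := sum_kernel_nbr_le hν hL hT hS hIR
  rw [kernelSymbol_stagChar_re_of_graded hL.two_dvd hgrad, sub_neg_eq_add, kernelSymbol_zero_re,
    ← hg0, ← hn] at h40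
  -- combine with (SD): `b ≤ (2ν/n)(g0 + g0) + 2 A S`
  have hcomb : b ≤ 2 * ν / n * (g0 + g0) + 2 * A * latticeS ν L := hSD.trans h40
  rw [div_mul_eq_mul_div, div_le_iff₀ (by positivity : (0 : ℝ) < 4 * ν)]
  have h2 : 2 * ν / n * (g0 + g0) = n⁻¹ * g0 * (4 * ν) := by
    field_simp
    ring
  linarith [hcomb, h2]

/-- The same conclusion on the torus `(ℤ/Lℤ)^ν` written with `|Λ| = L^ν`. [cite: SalmhoferSeiler1991, Thm. 4.8 ((4.40)–(4.42)) with (3.106)] -/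
theorem kernel_chiralLRO_of_bounds' (hν : 1 ≤ ν) (hL : Even L) {G : TorusSite ν L → TorusSite ν L → ℝ}
    (hT : ∀ x y a, G (x + a) (y + a) = G x y) (hS : ∀ x y, G x y = G y x)
    (hgrad : ∀ z, parity hL.two_dvd z = 0 → G 0 z = 0) {A b : ℝ}
    (hIR : ∀ χ : AddChar (TorusSite ν L) ℂ, χ ≠ 0 → χ ≠ stagChar hL.two_dvd →
      2 * ((ν : ℝ) - cosSum χ) * (kernelSymbol G χ).re ≤ A ∧
        2 * ((ν : ℝ) + cosSum χ) * (-(kernelSymbol G χ).re) ≤ A)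
    (hSD : b ≤ ∑ μ : Fin ν, (G 0 (Pi.single μ 1) + G 0 (-Pi.single μ 1))) :
    1 / (4 * ν) * (b - 2 * A * latticeS ν L) ≤ ((L : ℝ) ^ ν)⁻¹ * ∑ x : TorusSite ν L, G 0 x := by
  have hcard : (Fintype.card (TorusSite ν L) : ℝ) = (L : ℝ) ^ ν := by
    rw [Fintype.card_fun, ZMod.card, Fintype.card_fin, Nat.cast_pow]
  rw [← hcard]
  exact kernel_chiralLRO_of_bounds hν hL hT hS hgrad hIR hSD

/-- **Uniform version**: if the constants `A ≥ 0`, `b` of (IR) and (SD) satisfy `2A·S(ν) < b`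
(`S(ν)` the printed constant (4.3), the tree's `fluctS`; `ν ≥ 3`), then there are `c > 0` and `L₀`
such that EVERY graded kernel obeying (IR)/(SD) with these constants on an even torus of side
`L ≥ L₀` has `|Λ|⁻¹∑_x G(0,x) ≥ c` — the volume-uniform long-range order of (4.42), by
`S_Λ(ν) → S(ν)` (`latticeS_tendsto_fluctS`). [cite: SalmhoferSeiler1991, Thm. 4.8 ((4.41)–(4.42)) with Def. 4.1 (4.3)] -/
theorem kernel_chiralLRO_uniform (hν : 3 ≤ ν) {A b : ℝ} (hA : 0 ≤ A) (hAb : 2 * A * fluctS ν < b) :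
    ∃ c : ℝ, 0 < c ∧ ∃ L₀ : ℕ, ∀ (L : ℕ) [NeZero L] (hL : Even L), L₀ ≤ L →
      ∀ G : TorusSite ν L → TorusSite ν L → ℝ,
        (∀ x y a, G (x + a) (y + a) = G x y) → (∀ x y, G x y = G y x) →
        (∀ z, parity hL.two_dvd z = 0 → G 0 z = 0) →
        (∀ χ : AddChar (TorusSite ν L) ℂ, χ ≠ 0 → χ ≠ stagChar hL.two_dvd →
          2 * ((ν : ℝ) - cosSum χ) * (kernelSymbol G χ).re ≤ A ∧
            2 * ((ν : ℝ) + cosSum χ) * (-(kernelSymbol G χ).re) ≤ A) →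
        b ≤ ∑ μ : Fin ν, (G 0 (Pi.single μ 1) + G 0 (-Pi.single μ 1)) →
        c ≤ ((L : ℝ) ^ ν)⁻¹ * ∑ x : TorusSite ν L, G 0 x := by
  have hν1 : 1 ≤ ν := by omega
  have hνpos : (0 : ℝ) < ν := by exact_mod_cast hν1
  -- room: `δ := b - 2A·S(ν) > 0`; choose `ε` with `2Aε ≤ δ/2`
  set δ := b - 2 * A * fluctS ν with hδ
  have hδpos : 0 < δ := by rw [hδ]; linarith
  obtain ⟨L₀, hL₀⟩ := latticeS_tendsto_fluctS (ν := ν) hν (ε := δ / (4 * A + 4)) (by positivity)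
  refine ⟨1 / (4 * ν) * (δ / 2), by positivity, L₀, fun L _ hL hLe G hT hS hgrad hIR hSD => ?_⟩
  have hSΛ : latticeS ν L ≤ fluctS ν + δ / (4 * A + 4) := by
    have := hL₀ L hL hLe
    have := (abs_le.1 this).2
    linarith
  have h := kernel_chiralLRO_of_bounds' hν1 hL hT hS hgrad hIR hSD
  refine le_trans ?_ h
  refine mul_le_mul_of_nonneg_left ?_ (by positivity)
  -- `δ/2 ≤ b - 2A S_Λ`
  have h1 : 2 * A * latticeS ν L ≤ 2 * A * fluctS ν + 2 * A * (δ / (4 * A + 4)) := by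
    have := mul_le_mul_of_nonneg_left hSΛ (by positivity : (0 : ℝ) ≤ 2 * A)
    linarith
  have h2 : 2 * A * (δ / (4 * A + 4)) ≤ δ / 2 := by
    rw [mul_div_assoc', div_le_div_iff₀ (by positivity) (by positivity)]
    nlinarith
  linarith

/-! ### The regular part of the nearest-neighbour sum — the weakest form in which (4.12)–(4.14)
consume the infrared bound

The symbol sum (4.12)–(4.13) splits as ATOMS (the modes `k = 0` and `k = π̂`, carrying the long-range
order) plus the REGULAR PART `∑_{k ∉ {0,π̂}} 2C(k)Ĝ(k)`.  The printed argument uses the mode-wise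
infrared bound ONLY to bound the regular part by `2A·|Λ|·S_Λ(ν)` ((4.14)); any upper bound `r` on
`|Λ|⁻¹ × (regular part)` gives long-range order `≥ (1/4ν)(b - r)` verbatim, and a mode-wise bound with a
mode-dependent slack `A + e(k)` gives `r = 2A·S_Λ(ν) + |Λ|⁻¹∑ e(k)·(C/D folded)`.  Recorded for the
question "what does an extension of Salmhofer–Seiler to small `β > 0` need" (cell pub-ymgap, rung Q1):
the open input is an upper bound on ONE number per volume, the regular part of the nearest-neighbour sum. -/

/-- **Atoms + regular part** ((4.12)–(4.13) with the modes `0`, `π̂` split off): for a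
translation-invariant symmetric real kernel on the even torus `(ℤ/Lℤ)^ν` (`ν ≥ 1`),
`∑_μ (G(0,e_μ) + G(0,-e_μ)) = (2ν/|Λ|)(Ĝ(0) - Ĝ(π̂)) + |Λ|⁻¹ ∑_{χ ∉ {0,π̂}} Ĝ(χ)·2C(χ)`. [cite: SalmhoferSeiler1991, (4.12)–(4.14)] -/
theorem sum_kernel_nbr_eq_atoms_add_regular (hν : 1 ≤ ν) (hL : Even L)
    {G : TorusSite ν L → TorusSite ν L → ℝ}
    (hT : ∀ x y a, G (x + a) (y + a) = G x y) (hS : ∀ x y, G x y = G y x) :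
    ∑ μ : Fin ν, (G 0 (Pi.single μ 1) + G 0 (-Pi.single μ 1)) =
      2 * ν / (Fintype.card (TorusSite ν L) : ℝ) *
          ((kernelSymbol G (0 : AddChar (TorusSite ν L) ℂ)).re -
            (kernelSymbol G (stagChar (ν := ν) hL.two_dvd)).re) +
        (Fintype.card (TorusSite ν L) : ℝ)⁻¹ *
          ∑ χ ∈ (Finset.univ.erase (0 : AddChar (TorusSite ν L) ℂ)).erase (stagChar hL.two_dvd),
            (kernelSymbol G χ).re * (2 * cosSum χ) := by
  classical
  set ε := stagChar (ν := ν) (L := L) hL.two_dvd with hεdef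
  have hε0 : ε ≠ 0 := stagChar_ne_zero hL.two_dvd hν
  have hn : (Fintype.card (TorusSite ν L) : ℝ) ≠ 0 := Nat.cast_ne_zero.2 Fintype.card_ne_zero
  have hcε : cosSum ε = -(ν : ℝ) := by rw [hεdef]; exact cosSum_stagChar hL.two_dvd
  rw [sum_kernel_nbr_eq hT hS,
    ← Finset.add_sum_erase _ _ (Finset.mem_univ (0 : AddChar (TorusSite ν L) ℂ)),
    ← Finset.add_sum_erase _ _ (Finset.mem_erase.mpr ⟨hε0, Finset.mem_univ ε⟩), cosSum_zero, hcε]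
  field_simp
  ring

/-- **Order parameter + regular part** (chirally graded kernel): with (χ) `G(0,z) = 0` on even sites,
`∑_μ (G(0,e_μ) + G(0,-e_μ)) = 4ν·|Λ|⁻¹∑_x G(0,x) + |Λ|⁻¹ ∑_{χ ∉ {0,π̂}} Ĝ(χ)·2C(χ)` — in words: the
regular part is `2ν ×` (the mean of `G(0,·)` over the `2ν` nearest neighbours MINUS the mean of `G(0,·)`
over the `|Λ|/2` odd sites), the excess of the nearest-neighbour correlation over the long-range order. [cite: SalmhoferSeiler1991, (4.12)–(4.14) with (3.106)] -/
theorem sum_kernel_nbr_eq_order_add_regular (hν : 1 ≤ ν) (hL : Even L)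
    {G : TorusSite ν L → TorusSite ν L → ℝ}
    (hT : ∀ x y a, G (x + a) (y + a) = G x y) (hS : ∀ x y, G x y = G y x)
    (hgrad : ∀ z, parity hL.two_dvd z = 0 → G 0 z = 0) :
    ∑ μ : Fin ν, (G 0 (Pi.single μ 1) + G 0 (-Pi.single μ 1)) =
      4 * ν * ((Fintype.card (TorusSite ν L) : ℝ)⁻¹ * ∑ x : TorusSite ν L, G 0 x) +
        (Fintype.card (TorusSite ν L) : ℝ)⁻¹ *
          ∑ χ ∈ (Finset.univ.erase (0 : AddChar (TorusSite ν L) ℂ)).erase (stagChar hL.two_dvd),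
            (kernelSymbol G χ).re * (2 * cosSum χ) := by
  rw [sum_kernel_nbr_eq_atoms_add_regular hν hL hT hS, kernelSymbol_stagChar_re_of_graded hL.two_dvd hgrad,
    kernelSymbol_zero_re]
  ring

/-- **The regular part under a mode-wise infrared bound WITH SLACK**: if
`2(ν - C(χ))Ĝ(χ) ≤ A + e(χ)` and `-2(ν + C(χ))Ĝ(χ) ≤ A + e(χ)` for all `χ ∉ {0, π̂}` (any real slack
`e`), then `∑_{χ ∉ {0,π̂}} Ĝ(χ)·2C(χ) ≤ 2A·|Λ|·S_Λ(ν) + ∑_{χ ∉ {0,π̂}} e(χ)·modeTerm(C(χ))`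
(`modeTerm(c) = c/(ν-c)` for `c > 0`, `-c/(ν+c)` for `c < 0`: the folded integrand of (4.3)/(4.14)).
With `e = 0` this is (4.14)/(4.40). [cite: SalmhoferSeiler1991, (4.14) with (3.112)–(3.113)] -/
theorem regular_le_of_slack (hν : 1 ≤ ν) (hL : Even L) {G : TorusSite ν L → TorusSite ν L → ℝ} {A : ℝ}
    {e : AddChar (TorusSite ν L) ℂ → ℝ}
    (hIR : ∀ χ : AddChar (TorusSite ν L) ℂ, χ ≠ 0 → χ ≠ stagChar hL.two_dvd →
      2 * ((ν : ℝ) - cosSum χ) * (kernelSymbol G χ).re ≤ A + e χ ∧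
        2 * ((ν : ℝ) + cosSum χ) * (-(kernelSymbol G χ).re) ≤ A + e χ) :
    ∑ χ ∈ (Finset.univ.erase (0 : AddChar (TorusSite ν L) ℂ)).erase (stagChar hL.two_dvd),
        (kernelSymbol G χ).re * (2 * cosSum χ) ≤
      2 * A * ((Fintype.card (TorusSite ν L) : ℝ) * latticeS ν L) +
        ∑ χ ∈ (Finset.univ.erase (0 : AddChar (TorusSite ν L) ℂ)).erase (stagChar hL.two_dvd),
          e χ * modeTerm ν (cosSum χ) := by
  classical
  set ε := stagChar (ν := ν) (L := L) hL.two_dvd with hεdef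
  have hε0 : ε ≠ 0 := stagChar_ne_zero hL.two_dvd hν
  set R := (Finset.univ.erase (0 : AddChar (TorusSite ν L) ℂ)).erase ε with hR
  set t : AddChar (TorusSite ν L) ℂ → ℝ := fun χ =>
    if χ = 0 ∨ χ = ε then 0 else modeTerm ν (cosSum χ) with ht
  -- pointwise: `Ĝ·2C ≤ (A + e) modeTerm` off `{0, ε}`
  have hpt : ∀ χ ∈ R, (kernelSymbol G χ).re * (2 * cosSum χ) ≤ (A + e χ) * modeTerm ν (cosSum χ) := by
    intro χ hχ
    have hE : χ ≠ ε := Finset.ne_of_mem_erase hχ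
    have h0 : χ ≠ 0 := Finset.ne_of_mem_erase (Finset.mem_of_mem_erase hχ)
    have := two_cosSum_mul_kernelSymbol_re_le hL.two_dvd h0 hE (hIR χ h0 hE).1 (hIR χ h0 hE).2
    linarith [this]
  -- the sum of `modeTerm` over `R` is `2|Λ|S_Λ`
  have htR : ∀ χ ∈ R, t χ = modeTerm ν (cosSum χ) := by
    intro χ hχ
    have hE : χ ≠ ε := Finset.ne_of_mem_erase hχ
    have h0 : χ ≠ 0 := Finset.ne_of_mem_erase (Finset.mem_of_mem_erase hχ)
    simp only [ht, if_neg (not_or.mpr ⟨h0, hE⟩)]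
  have hsumt' : ∑ χ, t χ = ∑ χ ∈ R, t χ := by
    rw [hR, ← Finset.add_sum_erase _ _ (Finset.mem_univ (0 : AddChar (TorusSite ν L) ℂ)),
      ← Finset.add_sum_erase _ _ (Finset.mem_erase.mpr ⟨hε0, Finset.mem_univ ε⟩)]
    simp [ht]
  have ht_eq : ∑ χ, t χ = 2 * ((Fintype.card (TorusSite ν L) : ℝ) * latticeS ν L) :=
    sum_modeTerm_eq hL.two_dvd
  have hsumt : ∑ χ ∈ R, modeTerm ν (cosSum χ) = 2 * ((Fintype.card (TorusSite ν L) : ℝ) * latticeS ν L) := by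
    rw [← Finset.sum_congr rfl htR, ← hsumt', ht_eq]
  calc ∑ χ ∈ R, (kernelSymbol G χ).re * (2 * cosSum χ)
      ≤ ∑ χ ∈ R, (A + e χ) * modeTerm ν (cosSum χ) := Finset.sum_le_sum hpt
    _ = A * ∑ χ ∈ R, modeTerm ν (cosSum χ) + ∑ χ ∈ R, e χ * modeTerm ν (cosSum χ) := by
        rw [Finset.mul_sum, ← Finset.sum_add_distrib]
        exact Finset.sum_congr rfl fun χ _ => by ring
    _ = 2 * A * ((Fintype.card (TorusSite ν L) : ℝ) * latticeS ν L) +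
          ∑ χ ∈ R, e χ * modeTerm ν (cosSum χ) := by rw [hsumt]; ring

/-- **Long-range order from a bound on the regular part and the nearest-neighbour lower bound** — the
weakest form of Thm. 4.8's mechanism: for a translation-invariant symmetric chirally graded real kernel
on the even torus (`ν ≥ 1`), (REG) `|Λ|⁻¹∑_{χ ∉ {0,π̂}} Ĝ(χ)·2C(χ) ≤ r` and (SD)
`b ≤ ∑_μ (G(0,e_μ) + G(0,-e_μ))` give `|Λ|⁻¹∑_x G(0,x) ≥ (1/4ν)(b - r)`.  The printed (IR) enters
(4.40)–(4.42) only through (REG) with `r = 2A·S_Λ(ν)`. [cite: SalmhoferSeiler1991, Thm. 4.8 ((4.40)–(4.42)) with (4.12)–(4.14) and (3.106)] -/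
theorem kernel_chiralLRO_of_regularPart (hν : 1 ≤ ν) (hL : Even L) {G : TorusSite ν L → TorusSite ν L → ℝ}
    (hT : ∀ x y a, G (x + a) (y + a) = G x y) (hS : ∀ x y, G x y = G y x)
    (hgrad : ∀ z, parity hL.two_dvd z = 0 → G 0 z = 0) {b r : ℝ}
    (hREG : (Fintype.card (TorusSite ν L) : ℝ)⁻¹ *
        ∑ χ ∈ (Finset.univ.erase (0 : AddChar (TorusSite ν L) ℂ)).erase (stagChar hL.two_dvd),
          (kernelSymbol G χ).re * (2 * cosSum χ) ≤ r)
    (hSD : b ≤ ∑ μ : Fin ν, (G 0 (Pi.single μ 1) + G 0 (-Pi.single μ 1))) :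
    1 / (4 * ν) * (b - r) ≤ (Fintype.card (TorusSite ν L) : ℝ)⁻¹ * ∑ x : TorusSite ν L, G 0 x := by
  have hνpos : (0 : ℝ) < ν := Nat.cast_pos.mpr hν
  have h := sum_kernel_nbr_eq_order_add_regular hν hL hT hS hgrad
  rw [div_mul_eq_mul_div, div_le_iff₀ (by positivity : (0 : ℝ) < 4 * ν)]
  have : b ≤ 4 * ν * ((Fintype.card (TorusSite ν L) : ℝ)⁻¹ * ∑ x : TorusSite ν L, G 0 x) + r := by
    linarith [hSD, h, hREG]
  linarith

/-- The same conclusion on `(ℤ/Lℤ)^ν` written with `|Λ| = L^ν`. [cite: SalmhoferSeiler1991, Thm. 4.8 ((4.40)–(4.42)) with (4.12)–(4.14) and (3.106)] -/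
theorem kernel_chiralLRO_of_regularPart' (hν : 1 ≤ ν) (hL : Even L) {G : TorusSite ν L → TorusSite ν L → ℝ}
    (hT : ∀ x y a, G (x + a) (y + a) = G x y) (hS : ∀ x y, G x y = G y x)
    (hgrad : ∀ z, parity hL.two_dvd z = 0 → G 0 z = 0) {b r : ℝ}
    (hREG : ((L : ℝ) ^ ν)⁻¹ *
        ∑ χ ∈ (Finset.univ.erase (0 : AddChar (TorusSite ν L) ℂ)).erase (stagChar hL.two_dvd),
          (kernelSymbol G χ).re * (2 * cosSum χ) ≤ r)
    (hSD : b ≤ ∑ μ : Fin ν, (G 0 (Pi.single μ 1) + G 0 (-Pi.single μ 1))) :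
    1 / (4 * ν) * (b - r) ≤ ((L : ℝ) ^ ν)⁻¹ * ∑ x : TorusSite ν L, G 0 x := by
  have hcard : (Fintype.card (TorusSite ν L) : ℝ) = (L : ℝ) ^ ν := by
    rw [Fintype.card_fun, ZMod.card, Fintype.card_fin, Nat.cast_pow]
  rw [← hcard] at hREG ⊢
  exact kernel_chiralLRO_of_regularPart hν hL hT hS hgrad hREG hSD

/-- **Long-range order from an infrared bound WITH SLACK**: (IR)_e `2(ν ∓ C(χ))(±Ĝ(χ)) ≤ A + e(χ)` off
`{0, π̂}`, (χ) and (SD) give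
`|Λ|⁻¹∑_x G(0,x) ≥ (1/4ν)(b - 2A·S_Λ(ν) - |Λ|⁻¹∑_{χ ∉ {0,π̂}} e(χ)·modeTerm(C(χ)))` — the printed
bound (4.41)–(4.42) degraded by exactly the `C/D`-weighted average of the slack (`e = 0`:
`kernel_chiralLRO_of_bounds`). [cite: SalmhoferSeiler1991, Thm. 4.8 ((4.40)–(4.42)) with (4.14)] -/
theorem kernel_chiralLRO_of_slackBounds (hν : 1 ≤ ν) (hL : Even L) {G : TorusSite ν L → TorusSite ν L → ℝ}
    (hT : ∀ x y a, G (x + a) (y + a) = G x y) (hS : ∀ x y, G x y = G y x)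
    (hgrad : ∀ z, parity hL.two_dvd z = 0 → G 0 z = 0) {A b : ℝ} {e : AddChar (TorusSite ν L) ℂ → ℝ}
    (hIR : ∀ χ : AddChar (TorusSite ν L) ℂ, χ ≠ 0 → χ ≠ stagChar hL.two_dvd →
      2 * ((ν : ℝ) - cosSum χ) * (kernelSymbol G χ).re ≤ A + e χ ∧
        2 * ((ν : ℝ) + cosSum χ) * (-(kernelSymbol G χ).re) ≤ A + e χ)
    (hSD : b ≤ ∑ μ : Fin ν, (G 0 (Pi.single μ 1) + G 0 (-Pi.single μ 1))) :
    1 / (4 * ν) * (b - 2 * A * latticeS ν L -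
        (Fintype.card (TorusSite ν L) : ℝ)⁻¹ *
          ∑ χ ∈ (Finset.univ.erase (0 : AddChar (TorusSite ν L) ℂ)).erase (stagChar hL.two_dvd),
            e χ * modeTerm ν (cosSum χ)) ≤
      (Fintype.card (TorusSite ν L) : ℝ)⁻¹ * ∑ x : TorusSite ν L, G 0 x := by
  have hn : (0 : ℝ) < Fintype.card (TorusSite ν L) := Nat.cast_pos.2 Fintype.card_pos
  have hreg := regular_le_of_slack hν hL hIR
  have hmono := mul_le_mul_of_nonneg_left hreg (inv_nonneg.mpr hn.le)
  have hexp : (Fintype.card (TorusSite ν L) : ℝ)⁻¹ *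
      (2 * A * ((Fintype.card (TorusSite ν L) : ℝ) * latticeS ν L) +
        ∑ χ ∈ (Finset.univ.erase (0 : AddChar (TorusSite ν L) ℂ)).erase (stagChar hL.two_dvd),
          e χ * modeTerm ν (cosSum χ)) =
      2 * A * latticeS ν L + (Fintype.card (TorusSite ν L) : ℝ)⁻¹ *
        ∑ χ ∈ (Finset.univ.erase (0 : AddChar (TorusSite ν L) ℂ)).erase (stagChar hL.two_dvd),
          e χ * modeTerm ν (cosSum χ) := by
    field_simp
  rw [hexp] at hmono
  have h := kernel_chiralLRO_of_regularPart hν hL hT hS hgrad hmono hSD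
  have hνpos : (0 : ℝ) < ν := Nat.cast_pos.mpr hν
  refine le_trans (le_of_eq ?_) h
  ring

end ComplexSpin

end Literature.MathematicalPhysics.StatisticalMechanics

end
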